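import Literature.NumberTheory.Weil1964.LocalLinearChangeOfVariables
import Literature.NumberTheory.Automorphic.LocalFieldHaarBalls
import Mathlib.MeasureTheory.Measure.WithDensity
import HarnessLib

/-!
# Split-place fibre averages of the dot product: invariance under `(x, y) ↦ (g x, g′ y)` and homogeneity under
# `(x, y) ↦ (t x, t′ y)` (Weil 1965, n° 37 (36)–(40) at a split place)

Topic `NumberTheory/Weil1965`; namespace `Literature.NumberTheory.Weil1965.SplitPlace`.  THEOREMS ONLY (no definition, no
instance, no notation, no named fact, no `sorry`).  Cell `hodgecm-mathlib`, programme P4, ENGINE E-2 (Rallis inner product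
formula, rank one), child line `F0_E2SiegelWeilWeilRange`, stub `stub_SW2_siegelWeil`, identity road [Weil1965, Thm 4 n° 50 /
Thm 5 n° 52], row SW2c-SCAL (split place) of the E-2 lead's finding `F0/P4/E2-SW2c-FINDING.v0` §3 as cut by F0P2a-p08 (g4)
(FILE A `Weil1965/SplitPlaceFibreDensity`, signature line 2026-08-31T01:16:52Z).  HC_CM is proved only modulo the 7 printed
citations until rung 0 closes — nothing here bears on a summit statement.

SETTING.  `K` a non-archimedean local field with additive Haar measure `μ`, `X = K^ι × K^ι` with the product Haar measure
`π = μ^⊗ι ⊗ μ^⊗ι` and the split hermitian (= dot product) form `h(x, y) = x ⬝ᵥ y` — the local model of `V ⊗ E_v` at a place `v`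
of `F` SPLIT in the quadratic extension `E/F` (`E_v = F_v × F_v`, `U(V)(F_v) ≅ GL_N(F_v)`).  FILE A's fibre average is the
explicit integral `F^{avg}_Φ(b; r) = μ(𝔭^r)⁻¹ ∫_X 𝟙_{b + 𝔭^r}(x ⬝ᵥ y) Φ(x, y) dπ` (its `fibreAvg μ Φ b r`, unfolded here so that
this file does not depend on FILE A's internals); its limit `r → ∞` is the fibre density `F_Φ(b)` of `h_*(Φ π)`.

* §1 (generic) **`integral_comp_prodMap_linearEquiv`** — `∫ Φ(e₁ x, e₂ y) dπ = ‖det e₁‖⁻¹ ‖det e₂‖⁻¹ ∫ Φ dπ` for linear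
  automorphisms `e₁, e₂` of `K^ι` (the module of `e₁ × e₂`; [WeilBNT1967] Chap. I §2 Th. 3 Cor. 3 via the tree's
  `map_linearMap_pi_eq_smul`, and Fubini-free: `Measure.map_prod_map`); `schwartzBruhat_comp_prodMap_linearEquiv` —
  Schwartz–Bruhat functions stay Schwartz–Bruhat.
* §2 (INV) **`fibreAvgIntegral_comp_dual`** — for `g, g′ ∈ GL(K^ι)` with `g x ⬝ᵥ g′ y = x ⬝ᵥ y` (i.e. `g′ = (gᵀ)⁻¹`, the action
  of `U(V)(F_v) ≅ GL_N(F_v)` on `V_v = K^ι × K^ι`): `det g · det g′ = 1` (`det_mul_det_eq_one_of_dotProduct`) and the fibre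
  integrals, hence the fibre averages, of `Φ ∘ (g × g′)` and `Φ` agree [Weil1965, n° 37: `μ_{b,v}` is `G'_v`-invariant].
* §3 (SCAL) **`fibreAvgIntegral_comp_smul`** — for `t, t′ ∈ K` with `‖t t′‖ = q^{-k}`:
  `‖tt′‖^{|ι|} ∫ 𝟙_{b+𝔭^r}(x ⬝ᵥ y) Φ(t x, t′ y) dπ = ∫ 𝟙_{tt′b + 𝔭^{r+k}}(x ⬝ᵥ y) Φ dπ`, whence
  **`fibreAvg_comp_smul`**: `‖tt′‖^{|ι|} F^{avg}_{Φ∘(t,t′)}(b; r) = ‖tt′‖ · F^{avg}_Φ(tt′ b; r + k)` (i.e.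
  `F^{avg}_{Φ∘(t,t′)}(b; r) = ‖tt′‖^{1−|ι|} F^{avg}_Φ(tt′b; r + k)`) and the limit transport `tendsto_fibreAvg_comp_smul`
  (`r + k → ∞` with `r`) — Weil's torus scaling (36)–(40) at the split place, the input of the boundedness endgame of Thm 4
  (row SW2c-BOUND).  The `fibreDensity` corollaries (`F_{Φ∘(t,t′)}(b) = ‖tt′‖^{1−|ι|} F_Φ(tt′b)`) follow from FILE A's
  `tendsto_fibreAvg` by `tendsto_nhds_unique`; they are left to the SW2 assembly (this file imports no E-2 file).

## References
* [Weil1965] A. Weil, *Sur la formule de Siegel dans la théorie des groupes classiques*, Acta Math. 113 (1965) 1–87: n° 37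
  (the local measures `μ_{b,v}`, p. 54), n° 50 Thm 4 ((36)–(40), pp. 72–74), n° 52 Thm 5 (pp. 76–77).
* [WeilBNT1967] A. Weil, *Basic Number Theory*, Grundlehren 144 (1967), Chap. I §2, Th. 3 Cor. 3 (pp. 6–7): the module of a
  linear automorphism is `mod_K(det)`.
* [Tate1950] J. Tate, *Fourier analysis in number fields and Hecke's zeta-functions*, §2.2 (Lemma 2.2.5 `d(aξ) = |a| dξ`; the
  balls `𝔭^m`).
-/

set_option autoImplicit false

noncomputable section

open MeasureTheory ValuativeRel Filter Topology Set Matrix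
open scoped NNReal ENNReal Pointwise Matrix
open Literature.NumberTheory.GaloisRepresentations.IsNonarchimedeanLocalField
open Literature.NumberTheory.Automorphic
open Literature.NumberTheory.Weil1964

namespace Literature.NumberTheory.Weil1965.SplitPlace

variable {K : Type*} [Field K] [ValuativeRel K] [TopologicalSpace K] [IsNonarchimedeanLocalField K]
variable {ι : Type*} [Fintype ι]

/-! ## §0 Instance helper and linear algebra -/

/-- `K` is second countable, Hausdorff and locally compact (instance helpers). [folklore] -/
private theorem secondCountable : SecondCountableTopology K := secondCountableTopology_localField K

omit [ValuativeRel K] [TopologicalSpace K] [IsNonarchimedeanLocalField K] in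
/-- **Dual pairs of automorphisms have inverse determinants**: if `g x ⬝ᵥ g′ y = x ⬝ᵥ y` for all `x, y` (i.e. `g′ = (gᵀ)⁻¹`),
then `det g · det g′ = 1`. [cite: WeilBNT1967, Chap. I §2, Th. 3 Cor. 3, pp. 6–7] -/
theorem det_mul_det_eq_one_of_dotProduct [DecidableEq ι] (g g' : (ι → K) ≃ₗ[K] (ι → K))
    (hgg' : ∀ x y, g x ⬝ᵥ g' y = x ⬝ᵥ y) :
    LinearMap.det (g : (ι → K) →ₗ[K] (ι → K)) * LinearMap.det (g' : (ι → K) →ₗ[K] (ι → K)) = 1 := by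
  have hA : (LinearMap.toMatrix' (g : (ι → K) →ₗ[K] (ι → K)))ᵀ * LinearMap.toMatrix' (g' : (ι → K) →ₗ[K] (ι → K)) = 1 := by
    ext i j
    have h := hgg' (Pi.single i 1) (Pi.single j 1)
    rw [single_dotProduct, one_mul, Pi.single_apply] at h
    rw [Matrix.mul_apply, Matrix.one_apply, ← h, dotProduct]
    simp only [Matrix.transpose_apply, LinearMap.toMatrix'_apply, LinearEquiv.coe_coe]
  have hdet := congrArg Matrix.det hA
  rw [Matrix.det_mul, Matrix.det_transpose, Matrix.det_one, LinearMap.det_toMatrix', LinearMap.det_toMatrix'] at hdet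
  exact hdet

/-- `‖det g‖⁻¹ · ‖det g′‖⁻¹ = 1` for a dual pair `(g, g′)`. [cite: WeilBNT1967, Chap. I §2, Th. 3 Cor. 3, pp. 6–7] -/
theorem normAbs_det_inv_mul_eq_one_of_dotProduct (g g' : (ι → K) ≃ₗ[K] (ι → K))
    (hgg' : ∀ x y, g x ⬝ᵥ g' y = x ⬝ᵥ y) :
    (normAbs K (LinearMap.det (g : (ι → K) →ₗ[K] (ι → K))))⁻¹ *
        (normAbs K (LinearMap.det (g' : (ι → K) →ₗ[K] (ι → K))))⁻¹ = 1 := by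
  classical
  rw [← mul_inv, ← map_mul, det_mul_det_eq_one_of_dotProduct g g' hgg', map_one, inv_one]

/-! ## §1 The module of `e₁ × e₂` on `K^ι × K^ι` -/

section Generic

variable [MeasurableSpace K] [BorelSpace K] (μ : Measure K) [μ.IsAddHaarMeasure]

omit [BorelSpace K] in
/-- a Haar measure on `K` is `σ`-finite (instance helper). [folklore] -/
private theorem sigmaFinite_haar : SigmaFinite μ := by
  haveI : T2Space K := (isLocalField K).toT2Space
  haveI : LocallyCompactSpace K := (isLocalField K).toLocallyCompactSpace
  haveI : SecondCountableTopology K := secondCountable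
  infer_instance

/-- **The module of `e₁ × e₂`**: `∫ Φ(e₁ x, e₂ y) d(μ^⊗ι ⊗ μ^⊗ι) = ‖det e₁‖⁻¹ ‖det e₂‖⁻¹ ∫ Φ d(μ^⊗ι ⊗ μ^⊗ι)` for linear
automorphisms `e₁, e₂` of `K^ι` (the image of the product Haar measure under `e₁ × e₂` is `‖det e₁‖⁻¹‖det e₂‖⁻¹` times
itself). [cite: WeilBNT1967, Chap. I §2, Th. 3 Cor. 3, pp. 6–7] -/
theorem integral_comp_prodMap_linearEquiv {E : Type*} [NormedAddCommGroup E] [NormedSpace ℝ E]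
    (e₁ e₂ : (ι → K) ≃ₗ[K] (ι → K)) (Φ : (ι → K) × (ι → K) → E) :
    ∫ z, Φ (e₁ z.1, e₂ z.2) ∂((Measure.pi fun _ : ι => μ).prod (Measure.pi fun _ : ι => μ)) =
      (((normAbs K (LinearMap.det (e₁ : (ι → K) →ₗ[K] (ι → K))))⁻¹ *
          (normAbs K (LinearMap.det (e₂ : (ι → K) →ₗ[K] (ι → K))))⁻¹ : ℝ≥0) : ℝ) •
        ∫ z, Φ z ∂((Measure.pi fun _ : ι => μ).prod (Measure.pi fun _ : ι => μ)) := by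
  haveI := sigmaFinite_haar μ
  have hdet₁ : LinearMap.det (e₁ : (ι → K) →ₗ[K] (ι → K)) ≠ 0 := by
    simpa using (LinearEquiv.isUnit_det' e₁).ne_zero
  have hdet₂ : LinearMap.det (e₂ : (ι → K) →ₗ[K] (ι → K)) ≠ 0 := by
    simpa using (LinearEquiv.isUnit_det' e₂).ne_zero
  have h := integral_map_equiv (μ := (Measure.pi fun _ : ι => μ).prod (Measure.pi fun _ : ι => μ))
    ((linearEquivMeasurableEquiv e₁).prodCongr (linearEquivMeasurableEquiv e₂)) Φ
  have hem : (⇑((linearEquivMeasurableEquiv e₁).prodCongr (linearEquivMeasurableEquiv e₂)) :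
      (ι → K) × (ι → K) → (ι → K) × (ι → K)) =
      Prod.map (⇑(e₁ : (ι → K) →ₗ[K] (ι → K))) (⇑(e₂ : (ι → K) →ₗ[K] (ι → K))) := rfl
  rw [hem, ← Measure.map_prod_map _ _ (measurable_linearMap_pi (e₁ : (ι → K) →ₗ[K] (ι → K)))
      (measurable_linearMap_pi (e₂ : (ι → K) →ₗ[K] (ι → K))),
    map_linearMap_pi_eq_smul μ hdet₁, map_linearMap_pi_eq_smul μ hdet₂, Measure.prod_smul_left,
    Measure.prod_smul_right, integral_smul_measure, integral_smul_measure, ENNReal.coe_toReal, ENNReal.coe_toReal,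
    smul_smul, ← NNReal.coe_mul, map_inv₀, map_inv₀] at h
  exact h.symm

omit [MeasurableSpace K] [BorelSpace K] in
/-- **Schwartz–Bruhat functions are stable under `e₁ × e₂`**: `Φ ∘ (e₁ × e₂)` is locally constant and compactly supported
when `Φ` is. [cite: Tate1950, §2.2] -/
theorem schwartzBruhat_comp_prodMap_linearEquiv (e₁ e₂ : (ι → K) ≃ₗ[K] (ι → K)) {Φ : (ι → K) × (ι → K) → ℂ}
    (hΦ : Φ ∈ SchwartzBruhat ((ι → K) × (ι → K))) :
    (fun z : (ι → K) × (ι → K) => Φ (e₁ z.1, e₂ z.2)) ∈ SchwartzBruhat ((ι → K) × (ι → K)) := by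
  -- the linear automorphisms as homeomorphisms (linear maps on `K^ι` are continuous)
  let H₁ : (ι → K) ≃ₜ (ι → K) :=
    { toEquiv := e₁.toEquiv
      continuous_toFun := (e₁ : (ι → K) →ₗ[K] (ι → K)).continuous_on_pi
      continuous_invFun := (e₁.symm : (ι → K) →ₗ[K] (ι → K)).continuous_on_pi }
  let H₂ : (ι → K) ≃ₜ (ι → K) :=
    { toEquiv := e₂.toEquiv
      continuous_toFun := (e₂ : (ι → K) →ₗ[K] (ι → K)).continuous_on_pi
      continuous_invFun := (e₂.symm : (ι → K) →ₗ[K] (ι → K)).continuous_on_pi }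
  let H : (ι → K) × (ι → K) ≃ₜ (ι → K) × (ι → K) := H₁.prodCongr H₂
  have hH : (fun z : (ι → K) × (ι → K) => Φ (e₁ z.1, e₂ z.2)) = Φ ∘ H := rfl
  rw [mem_schwartzBruhat_iff] at hΦ ⊢
  rw [hH]
  exact ⟨hΦ.1.comp_continuous H.continuous, hΦ.2.comp_homeomorph H⟩

end Generic

/-! ## §2 (INV) Invariance of the fibre integrals under `(x, y) ↦ (g x, g′ y)`, `g x ⬝ᵥ g′ y = x ⬝ᵥ y` -/

section Invariance

variable [MeasurableSpace K] [BorelSpace K] (μ : Measure K) [μ.IsAddHaarMeasure]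

/-- **`G'_v`-invariance of the fibre integrals** (`U(V)(F_v) ≅ GL_N(F_v)` acting on `V_v = K^ι × K^ι` by `(g, (gᵀ)⁻¹)`):
`∫ 𝟙_S(x ⬝ᵥ y) Φ(g x, g′ y) dπ = ∫ 𝟙_S(x ⬝ᵥ y) Φ(x, y) dπ` for every set `S ⊆ K`, whenever `g x ⬝ᵥ g′ y = x ⬝ᵥ y`.
[cite: Weil1965, n° 37 (p. 54)] [cite: WeilBNT1967, Chap. I §2, Th. 3 Cor. 3, pp. 6–7] -/
theorem integral_indicator_dotProduct_comp_dual (g g' : (ι → K) ≃ₗ[K] (ι → K)) (hgg' : ∀ x y, g x ⬝ᵥ g' y = x ⬝ᵥ y)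
    (Φ : (ι → K) × (ι → K) → ℂ) (S : Set K) :
    ∫ z, S.indicator (1 : K → ℂ) (z.1 ⬝ᵥ z.2) * Φ (g z.1, g' z.2)
        ∂((Measure.pi fun _ : ι => μ).prod (Measure.pi fun _ : ι => μ)) =
      ∫ z, S.indicator (1 : K → ℂ) (z.1 ⬝ᵥ z.2) * Φ z ∂((Measure.pi fun _ : ι => μ).prod (Measure.pi fun _ : ι => μ)) := by
  have h := integral_comp_prodMap_linearEquiv μ g g' (fun w => S.indicator (1 : K → ℂ) (w.1 ⬝ᵥ w.2) * Φ w)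
  simp only [hgg'] at h
  rw [h, normAbs_det_inv_mul_eq_one_of_dotProduct g g' hgg', NNReal.coe_one, one_smul]

/-- **Invariance of the fibre averages** `F^{avg}_Φ(b; r) = μ(𝔭^r)⁻¹ ∫ 𝟙_{b+𝔭^r}(x ⬝ᵥ y) Φ dπ` (FILE A's `fibreAvg`, unfolded)
under `(x, y) ↦ (g x, g′ y)` with `g x ⬝ᵥ g′ y = x ⬝ᵥ y`. [cite: Weil1965, n° 37 (p. 54)] -/
theorem fibreAvg_comp_dual (g g' : (ι → K) ≃ₗ[K] (ι → K)) (hgg' : ∀ x y, g x ⬝ᵥ g' y = x ⬝ᵥ y)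
    (Φ : (ι → K) × (ι → K) → ℂ) (b : K) (r : ℤ) :
    (μ.real (primePowBall K r) : ℂ)⁻¹ *
        ∫ z, (b +ᵥ primePowBall K r).indicator (1 : K → ℂ) (z.1 ⬝ᵥ z.2) * Φ (g z.1, g' z.2)
          ∂((Measure.pi fun _ : ι => μ).prod (Measure.pi fun _ : ι => μ)) =
      (μ.real (primePowBall K r) : ℂ)⁻¹ *
        ∫ z, (b +ᵥ primePowBall K r).indicator (1 : K → ℂ) (z.1 ⬝ᵥ z.2) * Φ z
          ∂((Measure.pi fun _ : ι => μ).prod (Measure.pi fun _ : ι => μ)) := by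
  rw [integral_indicator_dotProduct_comp_dual μ g g' hgg' Φ]

end Invariance

/-! ## §3 (SCAL) Homogeneity of the fibre integrals under `(x, y) ↦ (t x, t′ y)` -/

section Scaling

variable [MeasurableSpace K] [BorelSpace K] (μ : Measure K) [μ.IsAddHaarMeasure]

omit [ValuativeRel K] [TopologicalSpace K] [IsNonarchimedeanLocalField K] [MeasurableSpace K] [BorelSpace K] in
/-- `(t x) ⬝ᵥ (t′ y) = (t t′) (x ⬝ᵥ y)`. [folklore] -/
private theorem smul_dotProduct_smul (t t' : K) (x y : ι → K) : (t • x) ⬝ᵥ (t' • y) = (t * t') * (x ⬝ᵥ y) := by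
  rw [smul_dotProduct, dotProduct_smul, smul_eq_mul, smul_eq_mul, mul_assoc]

omit [MeasurableSpace K] [BorelSpace K] in
/-- dilating a translated ball: `c • (b + 𝔭^r) = c b + 𝔭^{r+k}` for `‖c‖ = q^{-k}`. [cite: Tate1950, §2.2] -/
theorem smul_vadd_primePowBall {c : K} {k : ℤ} (hc : normAbs K c = ((residueFieldCard K : ℝ≥0)⁻¹) ^ k)
    (b : K) (r : ℤ) : c • (b +ᵥ primePowBall K r) = (c * b) +ᵥ primePowBall K (r + k) := by
  rw [← LocalFieldHaar.smul_primePowBall hc r]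
  ext u
  simp only [Set.mem_smul_set, Set.mem_vadd_set, vadd_eq_add, smul_eq_mul]
  constructor
  · rintro ⟨v, ⟨w, hw, rfl⟩, rfl⟩
    exact ⟨c * w, ⟨w, hw, rfl⟩, by ring⟩
  · rintro ⟨v, ⟨w, hw, rfl⟩, rfl⟩
    exact ⟨b + w, ⟨w, hw, rfl⟩, by ring⟩

omit [MeasurableSpace K] [BorelSpace K] in
/-- `‖c‖ = q^{-k}` forces `c ≠ 0`. [folklore] -/
private theorem ne_zero_of_normAbs_eq_zpow {c : K} {k : ℤ} (hc : normAbs K c = ((residueFieldCard K : ℝ≥0)⁻¹) ^ k) :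
    c ≠ 0 := by
  rintro rfl
  rw [map_zero] at hc
  exact (zpow_pos inv_residueFieldCard_pos k).ne hc

omit [MeasurableSpace K] [BorelSpace K] in
/-- the indicator of `b + 𝔭^r` at `c⁻¹ u` is the indicator of `c b + 𝔭^{r+k}` at `u` (`‖c‖ = q^{-k}`). [cite: Tate1950, §2.2] -/
theorem indicator_vadd_primePowBall_inv_mul {c : K} {k : ℤ} (hc : normAbs K c = ((residueFieldCard K : ℝ≥0)⁻¹) ^ k)
    (b : K) (r : ℤ) (u : K) :
    (b +ᵥ primePowBall K r).indicator (1 : K → ℂ) (c⁻¹ * u) =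
      ((c * b) +ᵥ primePowBall K (r + k)).indicator (1 : K → ℂ) u := by
  have hc0 := ne_zero_of_normAbs_eq_zpow hc
  have hmem : c⁻¹ * u ∈ b +ᵥ primePowBall K r ↔ u ∈ (c * b) +ᵥ primePowBall K (r + k) := by
    rw [← smul_vadd_primePowBall hc b r, Set.mem_smul_set_iff_inv_smul_mem₀ hc0, smul_eq_mul]
  by_cases hu : u ∈ (c * b) +ᵥ primePowBall K (r + k)
  · rw [Set.indicator_of_mem hu, Set.indicator_of_mem (hmem.2 hu)]
    rfl
  · rw [Set.indicator_of_notMem hu, Set.indicator_of_notMem (fun h => hu (hmem.1 h))]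

omit [MeasurableSpace K] [BorelSpace K] in
/-- `‖det (t • 1)‖ on `K^ι` is `‖t‖^{|ι|}`. [cite: WeilBNT1967, Chap. I §2, Th. 3 Cor. 3, pp. 6–7] -/
theorem normAbs_det_smul_id {t : K} (ht : t ≠ 0) :
    normAbs K (LinearMap.det ((LinearEquiv.smulOfUnit (Units.mk0 t ht) : (ι → K) ≃ₗ[K] (ι → K)) :
      (ι → K) →ₗ[K] (ι → K))) = normAbs K t ^ Fintype.card ι := by
  have h : ((LinearEquiv.smulOfUnit (Units.mk0 t ht) : (ι → K) ≃ₗ[K] (ι → K)) : (ι → K) →ₗ[K] (ι → K)) =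
      t • LinearMap.id := by
    ext x i
    rfl
  rw [h, LinearMap.det_smul, LinearMap.det_id, mul_one, Module.finrank_fintype_fun_eq_card, map_pow]

/-- **Torus scaling of the fibre integrals at a split place** [Weil1965 n° 50, (36)–(40)]: for `‖t t′‖ = q^{-k}`,
`‖tt′‖^{|ι|} ∫ 𝟙_{b+𝔭^r}(x ⬝ᵥ y) Φ(t x, t′ y) dπ = ∫ 𝟙_{tt′ b + 𝔭^{r+k}}(x ⬝ᵥ y) Φ(x, y) dπ` (substitute `(x, y) ↦ (t x, t′ y)`,
module `‖t‖^{|ι|}‖t′‖^{|ι|}`; `(tx) ⬝ᵥ (t′y) = tt′(x ⬝ᵥ y)` and `tt′·(b + 𝔭^r) = tt′b + 𝔭^{r+k}`).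
[cite: Weil1965, n° 50 Thm 4 (pp. 72–74)] [cite: WeilBNT1967, Chap. I §2, Th. 3 Cor. 3, pp. 6–7] -/
theorem fibreAvgIntegral_comp_smul {t t' : K} {k : ℤ} (hc : normAbs K (t * t') = ((residueFieldCard K : ℝ≥0)⁻¹) ^ k)
    (Φ : (ι → K) × (ι → K) → ℂ) (b : K) (r : ℤ) :
    ((normAbs K (t * t') : ℝ) : ℂ) ^ Fintype.card ι *
        ∫ z, (b +ᵥ primePowBall K r).indicator (1 : K → ℂ) (z.1 ⬝ᵥ z.2) * Φ (t • z.1, t' • z.2)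
          ∂((Measure.pi fun _ : ι => μ).prod (Measure.pi fun _ : ι => μ)) =
      ∫ z, (((t * t') * b) +ᵥ primePowBall K (r + k)).indicator (1 : K → ℂ) (z.1 ⬝ᵥ z.2) * Φ z
          ∂((Measure.pi fun _ : ι => μ).prod (Measure.pi fun _ : ι => μ)) := by
  have hc0 : t * t' ≠ 0 := ne_zero_of_normAbs_eq_zpow hc
  have ht : t ≠ 0 := left_ne_zero_of_mul hc0
  have ht' : t' ≠ 0 := right_ne_zero_of_mul hc0
  -- the substitution `(x, y) ↦ (t x, t′ y)` in the integral of `Ψ w := 𝟙_{b+𝔭^r}((tt′)⁻¹ (w.1 ⬝ᵥ w.2)) Φ w`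
  let e₁ : (ι → K) ≃ₗ[K] (ι → K) := LinearEquiv.smulOfUnit (Units.mk0 t ht)
  let e₂ : (ι → K) ≃ₗ[K] (ι → K) := LinearEquiv.smulOfUnit (Units.mk0 t' ht')
  have he₁ : ∀ x : ι → K, e₁ x = t • x := fun _ => rfl
  have he₂ : ∀ x : ι → K, e₂ x = t' • x := fun _ => rfl
  have h := integral_comp_prodMap_linearEquiv μ e₁ e₂
    (fun w => (b +ᵥ primePowBall K r).indicator (1 : K → ℂ) ((t * t')⁻¹ * (w.1 ⬝ᵥ w.2)) * Φ w)
  simp only [he₁, he₂, smul_dotProduct_smul, inv_mul_cancel_left₀ hc0] at h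
  rw [normAbs_det_smul_id ht, normAbs_det_smul_id ht'] at h
  simp only [indicator_vadd_primePowBall_inv_mul hc] at h
  rw [h]
  -- the scalar: `‖tt′‖^{|ι|} · (‖t‖^{|ι|})⁻¹ (‖t′‖^{|ι|})⁻¹ = 1`
  have hnn : normAbs K (t * t') ^ Fintype.card ι *
      ((normAbs K t ^ Fintype.card ι)⁻¹ * (normAbs K t' ^ Fintype.card ι)⁻¹) = 1 := by
    rw [map_mul, mul_pow, ← mul_inv, mul_inv_cancel₀]
    exact mul_ne_zero (pow_ne_zero _ ((map_ne_zero _).2 ht)) (pow_ne_zero _ ((map_ne_zero _).2 ht'))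
  have hscal : ((normAbs K (t * t') : ℝ) : ℂ) ^ Fintype.card ι *
      ((((normAbs K t ^ Fintype.card ι)⁻¹ * (normAbs K t' ^ Fintype.card ι)⁻¹ : ℝ≥0) : ℝ) : ℂ) = 1 := by
    have h1 := congrArg (fun x : ℝ≥0 => ((x : ℝ) : ℂ)) hnn
    simp only [NNReal.coe_mul, NNReal.coe_pow, Complex.ofReal_mul, Complex.ofReal_pow, NNReal.coe_one,
      Complex.ofReal_one] at h1
    rw [← h1]
    push_cast
    ring
  rw [Complex.real_smul, ← mul_assoc, hscal, one_mul]

/-- **Homogeneity of the fibre averages** (FILE A's `fibreAvg`, unfolded): for `‖t t′‖ = q^{-k}`,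
`‖tt′‖^{|ι|} F^{avg}_{Φ∘(t,t′)}(b; r) = ‖tt′‖ · F^{avg}_Φ(tt′b; r + k)`, i.e. `F^{avg}_{Φ∘(t,t′)}(b; r) = ‖tt′‖^{1−|ι|} F^{avg}_Φ(tt′b; r+k)`
(`μ(𝔭^{r+k}) = ‖tt′‖ μ(𝔭^r)`). [cite: Weil1965, n° 50 Thm 4 (pp. 72–74)] [cite: Tate1950, §2.2] -/
theorem fibreAvg_comp_smul {t t' : K} {k : ℤ} (hc : normAbs K (t * t') = ((residueFieldCard K : ℝ≥0)⁻¹) ^ k)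
    (Φ : (ι → K) × (ι → K) → ℂ) (b : K) (r : ℤ) :
    ((normAbs K (t * t') : ℝ) : ℂ) ^ Fintype.card ι *
        ((μ.real (primePowBall K r) : ℂ)⁻¹ *
          ∫ z, (b +ᵥ primePowBall K r).indicator (1 : K → ℂ) (z.1 ⬝ᵥ z.2) * Φ (t • z.1, t' • z.2)
            ∂((Measure.pi fun _ : ι => μ).prod (Measure.pi fun _ : ι => μ))) =
      ((normAbs K (t * t') : ℝ) : ℂ) *
        ((μ.real (primePowBall K (r + k)) : ℂ)⁻¹ *
          ∫ z, (((t * t') * b) +ᵥ primePowBall K (r + k)).indicator (1 : K → ℂ) (z.1 ⬝ᵥ z.2) * Φ z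
            ∂((Measure.pi fun _ : ι => μ).prod (Measure.pi fun _ : ι => μ))) := by
  rw [mul_left_comm, fibreAvgIntegral_comp_smul μ hc Φ b r, ← mul_assoc]
  congr 1
  -- `μ(𝔭^r)⁻¹ = ‖tt′‖ · μ(𝔭^{r+k})⁻¹`
  have hc0 : t * t' ≠ 0 := ne_zero_of_normAbs_eq_zpow hc
  have hq : ((residueFieldCard K : ℝ)⁻¹) ≠ 0 := inv_ne_zero (Nat.cast_ne_zero.2 (residueFieldCard_ne_zero K))
  have hcne : ((normAbs K (t * t') : ℝ) : ℂ) ≠ 0 := by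
    exact_mod_cast (map_ne_zero (normAbs K)).2 hc0
  have hratio : μ.real (primePowBall K (r + k)) = (normAbs K (t * t') : ℝ) * μ.real (primePowBall K r) := by
    rw [LocalFieldHaar.measureReal_primePowBall μ (r + k), LocalFieldHaar.measureReal_primePowBall μ r, hc, zpow_add₀ hq,
      NNReal.coe_zpow, NNReal.coe_inv, NNReal.coe_natCast]
    ring
  rw [eq_comm, hratio]
  push_cast
  rw [mul_inv, ← mul_assoc, mul_inv_cancel₀ hcne, one_mul]

/-- **Limit transport**: if the fibre averages of `Φ` at `tt′b` converge to `L` as `r → ∞`, those of `Φ ∘ (t, t′)` at `b`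
converge to `‖tt′‖ (‖tt′‖^{|ι|})⁻¹ L = ‖tt′‖^{1−|ι|} L` (so, with FILE A's `tendsto_fibreAvg`,
`F_{Φ∘(t,t′)}(b) = ‖tt′‖^{1−|ι|} F_Φ(tt′b)` by uniqueness of limits). [cite: Weil1965, n° 50 Thm 4 (pp. 72–74)] -/
theorem tendsto_fibreAvg_comp_smul {t t' : K} {k : ℤ} (hc : normAbs K (t * t') = ((residueFieldCard K : ℝ≥0)⁻¹) ^ k)
    (Φ : (ι → K) × (ι → K) → ℂ) (b : K) {L : ℂ}
    (hL : Tendsto (fun r : ℤ => (μ.real (primePowBall K r) : ℂ)⁻¹ *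
      ∫ z, (((t * t') * b) +ᵥ primePowBall K r).indicator (1 : K → ℂ) (z.1 ⬝ᵥ z.2) * Φ z
        ∂((Measure.pi fun _ : ι => μ).prod (Measure.pi fun _ : ι => μ))) atTop (𝓝 L)) :
    Tendsto (fun r : ℤ => (μ.real (primePowBall K r) : ℂ)⁻¹ *
      ∫ z, (b +ᵥ primePowBall K r).indicator (1 : K → ℂ) (z.1 ⬝ᵥ z.2) * Φ (t • z.1, t' • z.2)
        ∂((Measure.pi fun _ : ι => μ).prod (Measure.pi fun _ : ι => μ))) atTop
      (𝓝 (((normAbs K (t * t') : ℝ) : ℂ) * (((normAbs K (t * t') : ℝ) : ℂ) ^ Fintype.card ι)⁻¹ * L)) := by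
  have hc0 : t * t' ≠ 0 := ne_zero_of_normAbs_eq_zpow hc
  have hn : ((normAbs K (t * t') : ℝ) : ℂ) ^ Fintype.card ι ≠ 0 :=
    pow_ne_zero _ (by exact_mod_cast (map_ne_zero (normAbs K)).2 hc0)
  -- rewrite each term by `fibreAvg_comp_smul`
  have hterm : ∀ r : ℤ, (μ.real (primePowBall K r) : ℂ)⁻¹ *
      ∫ z, (b +ᵥ primePowBall K r).indicator (1 : K → ℂ) (z.1 ⬝ᵥ z.2) * Φ (t • z.1, t' • z.2)
        ∂((Measure.pi fun _ : ι => μ).prod (Measure.pi fun _ : ι => μ)) =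
      ((normAbs K (t * t') : ℝ) : ℂ) * (((normAbs K (t * t') : ℝ) : ℂ) ^ Fintype.card ι)⁻¹ *
        ((μ.real (primePowBall K (r + k)) : ℂ)⁻¹ *
          ∫ z, (((t * t') * b) +ᵥ primePowBall K (r + k)).indicator (1 : K → ℂ) (z.1 ⬝ᵥ z.2) * Φ z
            ∂((Measure.pi fun _ : ι => μ).prod (Measure.pi fun _ : ι => μ))) := by
    intro r
    have h := congrArg (fun x => (((normAbs K (t * t') : ℝ) : ℂ) ^ Fintype.card ι)⁻¹ * x) (fibreAvg_comp_smul μ hc Φ b r)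
    simp only at h
    rw [← mul_assoc, inv_mul_cancel₀ hn, one_mul] at h
    rw [h]
    ring
  simp_rw [hterm]
  exact (hL.comp (tendsto_atTop_add_const_right atTop k tendsto_id)).const_mul _

end Scaling

end Literature.NumberTheory.Weil1965.SplitPlace

end
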